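import Literature.Barriers.CriticalPhenomena.PlaquetteWalkYBCurveIdentityAllSpins
import Literature.Barriers.CriticalPhenomena.PlaquetteWalkIsthmusRoot
import HarnessLib

/-!
# Barrier catalogue (SAWScalingLimit), positive side: the Yang–Baxter identity at ISTHMUS hole roots,
away from the root plaquette, at EVERY admissible spin — and the spin-transfer API

Companion of `PlaquetteWalkIsthmusRoot` (at `σ = 5/8`: from an isthmus hole root `w.side σ` — the
plaquette across `σ` missing, the opposite side of `w` an outer root — the Yang–Baxter vertex functional
vanishes at every plaquette `f₀ ≠ w`, for the printed weights and on the complexified curve at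
`t₀ = e^{−5iπ/16}`) and of `PlaquetteWalkYBCurveIdentityAllSpins` (the curve identity for OUTER roots at
all sixteen spins `t¹⁶ = −1`). Two short consequences:

* `vertexFunctional_ybCurve_eq_zero_of_isthmus_of_pow_sixteen` — the isthmus identity at EVERY
  admissible spin: the tree's decomposition `vertexFunctional_isthmus` (general weights) reduces the
  functional from `w.side σ` on `Dl` to outer-rooted functionals on `Dl ∖ {w}`, which vanish by
  `vertexFunctional_ybCurve_eq_zero_of_pow_sixteen`; named `PlaquetteWalkYBIdentityIsthmusAllSpins` /
  `_holds`;
* `ExactPlaquetteVertexRelationOuter` and `PlaquetteWalkYBClassificationOuter_holds` — the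
  classification in the LARGEST class where identities exist (every finite face list, every OUTER root):
  for `u₁u₂v ≠ 0`, `t ≠ 0`, (∃ c ≠ 0, outer-root relation) ⇔ (t¹⁶ = −1 ∧ W on the curve); with the tree's
  `PlaquetteWalkNoAllRootsRelation`, admitting hole roots empties the class;
* `vertexFunctional_ybCurve_transfer` — the SPIN-TRANSFER API behind the all-spins file, made
  reusable: for fixed `(Dl, a, f₀)` (any root, outer or not), if the curve functional with coefficients
  `(1, r, −1, −r)` vanishes at ONE admissible spin `t₀` for every good `r`, it vanishes at every
  admissible spin `t₁` for every good `r` (Galois conjugation: `Φ₃₂ = T¹⁶ + 1` is irreducible over `ℚ`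
  and the functional lies in `ℚ(t, r)`).

Sources: [cite: GlazmanManolescu2019, Lemma 2.1]; [cite: Glazman2015WeightedSAW, Lemma 3.1 (the σ = ℓ/8 families)];
the root/domain hypothesis of print [cite: DuminilCopinSmirnov2012, §2 and proof of Lemma 1 (arXiv p. 4)].
Status in print: as for the two companions (CONSOLIDATION beyond the printed root hypothesis; the
Galois transfer not located in print — venture lane «pcv-sawmu», b-engine-1 gen 11, successor car).

Implementation note: the transfer API re-exports the private `IsRat2` machinery of
`PlaquetteWalkYBCurveIdentityAllSpins` via `open private … from`; nothing else is opened besides the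
private isthmus helpers `nbr_opp_not_mem`, `mem_eraseFace` of `PlaquetteWalkIsthmusRoot`.
-/

noncomputable section

namespace Literature.Barriers.CriticalPhenomena.PlaquetteWalk

open Literature.Probability.RandomPlanarGeometry.SAW.YangBaxter Real Complex

open private nbr_opp_not_mem mem_eraseFace from Literature.Barriers.CriticalPhenomena.PlaquetteWalkIsthmusRoot
open private ev DD ev_DD IsRat2 IsRat2.eq_zero_of_spin isRat2_vertexFunctional ne_zero_of_pow_sixteen
  pow_four_ne_one_of_pow_sixteen from Literature.Barriers.CriticalPhenomena.PlaquetteWalkYBCurveIdentityAllSpins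

/-! ### The isthmus identity at every admissible spin -/

/-- **The Yang–Baxter identity from an isthmus hole root, away from the root plaquette, at EVERY
admissible spin**: for `t¹⁶ = −1`, `r ≠ 0` off the curve's denominator, every face list `Dl`, every
`w ∈ Dl` and side `σ` with the plaquette across `σ` missing and `w.side σ.opp` an outer root, and every
`f₀ ∈ Dl`, `f₀ ≠ w`: the functional of `ybCurve (−1) t r` with `(1, r, −1, −r)` from `w.side σ`
vanishes at `f₀`. [cite: GlazmanManolescu2019, Lemma 2.1 (beyond the printed root hypothesis)]
[cite: Glazman2015WeightedSAW, Lemma 3.1 (all σ = ℓ/8)] -/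
theorem vertexFunctional_ybCurve_eq_zero_of_isthmus_of_pow_sixteen {t : ℂ} (h16 : t ^ 16 = -1) {r : ℂ}
    (hr : r ≠ 0) (hD : t ^ 6 * (1 + r ^ 4) - (1 + t ^ 12) * r ^ 2 ≠ 0)
    (Dl : List Face) (w : Face) (σ : Side) (hw : w ∈ Dl) (hh : nbr w σ ∉ dom Dl)
    (hO : OuterRoot (dom Dl) (w.side σ.opp)) (f₀ : Face) (hf : f₀ ∈ Dl) (hne : f₀ ≠ w) :
    vertexFunctional (ybCurve (-1) t r) t (oddCoeff r) Dl (w.side σ) f₀ = 0 := by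
  rw [vertexFunctional_isthmus _ (ne_zero_of_pow_sixteen h16) _ hw hh (nbr_opp_not_mem hw hO) hf hne]
  refine Finset.sum_eq_zero fun s _ => ?_
  rw [vertexFunctional_ybCurve_eq_zero_of_pow_sixteen h16 hr hD (eraseFace Dl w) (w.side s)
    (outerRoot_eraseFace hw hO s) f₀ (mem_eraseFace.2 ⟨hf, hne⟩), mul_zero]

/-- **Named statement `PlaquetteWalkYBIdentityIsthmusAllSpins`.** [cite: GlazmanManolescu2019, Lemma 2.1]
[cite: Glazman2015WeightedSAW, Lemma 3.1] -/
def _root_.Literature.Barriers.CriticalPhenomena.PlaquetteWalkYBIdentityIsthmusAllSpins : Prop :=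
  ∀ t : ℂ, t ^ 16 = -1 → ∀ r : ℂ, r ≠ 0 → t ^ 6 * (1 + r ^ 4) - (1 + t ^ 12) * r ^ 2 ≠ 0 →
    ∀ (Dl : List Face) (w : Face) (σ : Side) (f₀ : Face), w ∈ Dl → nbr w σ ∉ dom Dl →
      OuterRoot (dom Dl) (w.side σ.opp) → f₀ ∈ Dl → f₀ ≠ w →
        vertexFunctional (ybCurve (-1) t r) t (oddCoeff r) Dl (w.side σ) f₀ = 0

/-- **`PlaquetteWalkYBIdentityIsthmusAllSpins` holds.** [cite: GlazmanManolescu2019, Lemma 2.1] -/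
theorem _root_.Literature.Barriers.CriticalPhenomena.PlaquetteWalkYBIdentityIsthmusAllSpins_holds :
    PlaquetteWalkYBIdentityIsthmusAllSpins :=
  fun _ h16 _ hr hD Dl w σ f₀ hw hh hO hf hne =>
    vertexFunctional_ybCurve_eq_zero_of_isthmus_of_pow_sixteen h16 hr hD Dl w σ hw hh hO f₀ hf hne

/-- Consistency: the tree's `σ = 5/8` isthmus identity on the curve is the member `t = e^{−5iπ/16}`.
[cite: GlazmanManolescu2019, Lemma 2.1] -/
example {r : ℂ} (hr : r ≠ 0) (hD : tFiveEighths ^ 6 * (1 + r ^ 4) - (1 + tFiveEighths ^ 12) * r ^ 2 ≠ 0)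
    (Dl : List Face) (w : Face) (σ : Side) (hw : w ∈ Dl) (hh : nbr w σ ∉ dom Dl)
    (hO : OuterRoot (dom Dl) (w.side σ.opp)) (f₀ : Face) (hf : f₀ ∈ Dl) (hne : f₀ ≠ w) :
    vertexFunctional (ybCurve (-1) tFiveEighths r) tFiveEighths (oddCoeff r) Dl (w.side σ) f₀ = 0 :=
  vertexFunctional_ybCurve_eq_zero_of_isthmus_of_pow_sixteen tFiveEighths_pow_sixteen hr hD Dl w σ hw hh hO f₀ hf hne

/-! ### The spin-transfer API -/

/-- **Spin transfer, pointwise in `(Dl, a, f₀)`**: if the curve functional with coefficients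
`(1, r, −1, −r)` vanishes at one admissible spin `t₀` (`t₀¹⁶ = −1`) for every `r ≠ 0` off the curve's
denominator, then it vanishes at every admissible spin `t₁` for every such `r` — for ANY root `a`
(outer or not) and any face `f₀`. [cite: Glazman2015WeightedSAW, Lemma 3.1 (the σ = ℓ/8 families)] -/
theorem vertexFunctional_ybCurve_transfer (Dl : List Face) (a : MidEdge) (f₀ : Face) {t₀ t₁ : ℂ}
    (h₀ : t₀ ^ 16 = -1) (h₁ : t₁ ^ 16 = -1)
    (hz : ∀ r : ℂ, r ≠ 0 → t₀ ^ 6 * (1 + r ^ 4) - (1 + t₀ ^ 12) * r ^ 2 ≠ 0 →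
      vertexFunctional (ybCurve (-1) t₀ r) t₀ (oddCoeff r) Dl a f₀ = 0)
    {r : ℂ} (hr : r ≠ 0) (hD : t₁ ^ 6 * (1 + r ^ 4) - (1 + t₁ ^ 12) * r ^ 2 ≠ 0) :
    vertexFunctional (ybCurve (-1) t₁ r) t₁ (oddCoeff r) Dl a f₀ = 0 := by
  have hgood : ev t₁ r DD ≠ 0 := by
    rw [ev_DD]
    exact mul_ne_zero (mul_ne_zero (mul_ne_zero (ne_zero_of_pow_sixteen h₁) hr)
      (sub_ne_zero.2 (pow_four_ne_one_of_pow_sixteen h₁))) hD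
  refine IsRat2.eq_zero_of_spin (isRat2_vertexFunctional Dl a f₀) h₀ h₁ (fun x hx => ?_) hgood
  rw [ev_DD] at hx
  obtain ⟨h123, hxD⟩ := mul_ne_zero_iff.1 hx
  obtain ⟨h12, -⟩ := mul_ne_zero_iff.1 h123
  obtain ⟨-, hx0⟩ := mul_ne_zero_iff.1 h12
  exact hz x hx0 hxD

/-- Consistency: the all-spins curve identity is the transfer of the `σ = 5/8` one.
[cite: GlazmanManolescu2019, Lemma 2.1] -/
example {t : ℂ} (h16 : t ^ 16 = -1) {r : ℂ} (hr : r ≠ 0)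
    (hD : t ^ 6 * (1 + r ^ 4) - (1 + t ^ 12) * r ^ 2 ≠ 0) (Dl : List Face) (a : MidEdge)
    (hO : OuterRoot (dom Dl) a) (f₀ : Face) (hf : f₀ ∈ Dl) :
    vertexFunctional (ybCurve (-1) t r) t (oddCoeff r) Dl a f₀ = 0 :=
  vertexFunctional_ybCurve_transfer Dl a f₀ tFiveEighths_pow_sixteen h16
    (fun _ hx0 hxD => PlaquetteWalkYBCurveIdentity_holds _ hx0 hxD Dl a f₀ hf hO) hr hD

/-! ### The OUTER-root class is exactly the curve (every admissible spin) -/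

/-- **Technique class, outer roots on general face lists** `ExactPlaquetteVertexRelationOuter W t c`:
the relation at every face of EVERY finite face list for every OUTER root (a root from which an
exterior king-chain leaves every bounding box — hole roots excluded, nothing else).
[cite: GlazmanManolescu2019, Lemma 2.1 (walks from an outer boundary point)] -/
def ExactPlaquetteVertexRelationOuter (W : CWeights) (t : ℂ) (c : Fin 4 → ℂ) : Prop :=
  ∀ (Dl : List Face) (a : MidEdge) (f₀ : Face), f₀ ∈ Dl → OuterRoot (dom Dl) a →
    vertexFunctional W t c Dl a f₀ = 0

/-- The outer-root class implies the row-convex class (every boundary root of a row-convex list is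
outer). [cite: GlazmanManolescu2019, Lemma 2.1] -/
theorem ExactPlaquetteVertexRelationOuter.toRC {W : CWeights} {t : ℂ} {c : Fin 4 → ℂ}
    (h : ExactPlaquetteVertexRelationOuter W t c) : ExactPlaquetteVertexRelationRC W t c :=
  fun Dl a f₀ hD hf ha => h Dl a f₀ hf (outerRoot_of_noHoles (noHoles_of_rowConvex hD) ha)

/-- **Named statement `PlaquetteWalkYBClassificationOuter`** — the classification in the largest class
where identities exist: for `u₁u₂v ≠ 0` and `t ≠ 0`, SOME nonzero coefficient vector gives the relation
at every face of every finite face list for every OUTER root iff `t¹⁶ = −1` and the weights lie on the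
complexified Yang–Baxter curve of that spin. (With `PlaquetteWalkNoAllRootsRelation`: admitting hole
roots empties the class.) [cite: GlazmanManolescu2019, Lemma 2.1] [cite: Glazman2015WeightedSAW, Lemma 3.1] -/
def _root_.Literature.Barriers.CriticalPhenomena.PlaquetteWalkYBClassificationOuter : Prop :=
  ∀ (W : CWeights) (t : ℂ), t ≠ 0 → W.u₁ ≠ 0 → W.u₂ ≠ 0 → W.v ≠ 0 →
    ((∃ c : Fin 4 → ℂ, c ≠ 0 ∧ ExactPlaquetteVertexRelationOuter W t c) ↔
      (t ^ 16 = -1 ∧ ∃ ε r : ℂ, (ε = 1 ∨ ε = -1) ∧ W = ybCurve ε t r))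

/-- **`PlaquetteWalkYBClassificationOuter` holds**: (→) through the row-convex class and the tree's
all-spins classification; (←) the all-spins curve identity for outer roots (odd component) and its
sign-gauge twin (even component). [cite: GlazmanManolescu2019, Lemma 2.1] [cite: Glazman2015WeightedSAW, Lemma 3.1] -/
theorem _root_.Literature.Barriers.CriticalPhenomena.PlaquetteWalkYBClassificationOuter_holds :
    PlaquetteWalkYBClassificationOuter := by
  intro W t ht h1 h2 hv
  constructor
  · rintro ⟨c, hc, hrel⟩
    exact (PlaquetteWalkYBClassificationAllSpins_holds W t ht h1 h2 hv).1 ⟨c, hc, hrel.toRC⟩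
  · rintro ⟨h16, ε, r, hε, rfl⟩
    have hr : r ≠ 0 := by rintro rfl; apply h1; simp [ybCurve, ybU1]
    have hD : t ^ 6 * (1 + r ^ 4) - (1 + t ^ 12) * r ^ 2 ≠ 0 := by
      intro h; apply hv; show ybV ε t r = 0; rw [ybV, h, div_zero]
    rcases hε with rfl | rfl
    · refine ⟨gaugeCoeff (oddCoeff r), fun h => oddCoeff_ne_zero r (by
        rw [← gaugeCoeff_gaugeCoeff (oddCoeff r), h]; funext i; fin_cases i <;> simp [gaugeCoeff]), ?_⟩
      intro Dl a f₀ hf hO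
      rw [ybCurve_one_eq_gauge, signGauge, vertexFunctional_gauge,
        vertexFunctional_ybCurve_eq_zero_of_pow_sixteen h16 hr hD Dl a hO f₀ hf, mul_zero]
    · exact ⟨oddCoeff r, oddCoeff_ne_zero r, fun Dl a f₀ hf hO =>
        vertexFunctional_ybCurve_eq_zero_of_pow_sixteen h16 hr hD Dl a hO f₀ hf⟩

end Literature.Barriers.CriticalPhenomena.PlaquetteWalk
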